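import Summits.MatrixMultiplication.OmegaCensus.DihC3SqCoord

/-!
# ω-census, family (b3): conjecture C9 — more coordinate algebra of the class `𝒞₂` (`DihC3Sq.Coord2`), for lifting it through a central extension

HONEST FRAMING (pub-omega census; verbatim): lottery ticket; floor = certified bounds/negative ranges.
Census BOOKKEEPING (conjecture C9 of the cell, STRUCTURE.md §2; pub-omega kernel-l4 gen 16, task K-5, structure part;
preparation for the `𝒞₂` case of the centre-lifting theorem).  For a group `H` carrying `Coord2 c₁ c₂ κ₁ κ₂ ε`
(`K = ⟨c₁, c₂⟩ ≅ C₃²`, sign `ε`, crossed coordinates `κᵢ`, all commutators in `K`):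
* `eps_pow`, `eps_eq_one_of_odd`: `ε(gⁿ) = ε(g)ⁿ`, so elements of odd order have `ε = 1`;
* `kap_conj_inK`: `κᵢ(g k g⁻¹) = ε(g) κᵢ(k)` for `k ∈ K`; hence `conj_inK`: `g k g⁻¹ = k` if `ε g = 1` and `= k⁻¹` if `ε g = -1`;
* `comm_of_eps_one`: two elements with `ε = 1` commute iff … — precisely: `ε x = ε g = 1 ⇒ x g = g x`; `central_of_kap_zero`:
  `ε g = 1`, `κ₁ g = κ₂ g = 0 ⇒ g` is central; `kap_pow_of_eps_one`: `κᵢ(gⁿ) = n κᵢ(g)` when `ε g = 1`, so an element of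
  order prime to `3` with `ε = 1` has `κ = 0` and is central (`central_of_eps_one_of_coprime`);
* `kap_inK_pow`: coordinates of `c₁^a c₂^b`.
Pure algebra of the package; nothing here is progress on `ω`.
-/

namespace Summit.MatrixMultiplication.OmegaCensus

namespace CoordLift

open DihC3Sq

variable {H : Type*} [Group H] {c₁ c₂ : H} {κ₁ κ₂ ε : H → ZMod 3} (h : Coord2 c₁ c₂ κ₁ κ₂ ε)
include h

/-- `ε(gⁿ) = ε(g)ⁿ`. [folklore] -/
theorem eps_pow (g : H) (n : ℕ) : ε (g ^ n) = ε g ^ n := by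
  induction n with
  | zero => rw [pow_zero, pow_zero]; exact h.eps_one₂.symm
  | succ n ih => rw [pow_succ, h.eps_mul, ih, pow_succ]

/-- Elements of odd order have `ε = 1`. [folklore] -/
theorem eps_eq_one_of_odd {g : H} (hodd : Odd (orderOf g)) : ε g = 1 := by
  rcases h.sign g with e | e
  · exact e
  · exfalso
    have := eps_pow h g (orderOf g)
    rw [pow_orderOf_eq_one, ← h.eps_one₂, e, hodd.neg_one_pow] at this
    exact absurd this (by decide)

/-- `κ₁(g k g⁻¹) = ε(g) κ₁(k)` for `k ∈ K`. [folklore] -/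
theorem kap1_conj_inK (g : H) {k : H} (hk : InK2 c₁ c₂ k) : κ₁ (g * k * g⁻¹) = ε g * κ₁ k := by
  rw [h.kap1_mul, h.kap1_mul, h.kap1_inv, h.eps_mul, h.inK_eps hk, mul_one]
  linear_combination (-(κ₁ g)) * h.eps_sq g

/-- `κ₂(g k g⁻¹) = ε(g) κ₂(k)` for `k ∈ K`. [folklore] -/
theorem kap2_conj_inK (g : H) {k : H} (hk : InK2 c₁ c₂ k) : κ₂ (g * k * g⁻¹) = ε g * κ₂ k := by
  rw [h.kap2_mul, h.kap2_mul, h.kap2_inv, h.eps_mul, h.inK_eps hk, mul_one]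
  linear_combination (-(κ₂ g)) * h.eps_sq g

/-- `κ₁(k⁻¹) = -κ₁ k` for `k ∈ K`. [folklore] -/
theorem kap1_inv_inK {k : H} (hk : InK2 c₁ c₂ k) : κ₁ k⁻¹ = -κ₁ k := by
  rw [h.kap1_inv, h.inK_eps hk, one_mul]

/-- `κ₂(k⁻¹) = -κ₂ k` for `k ∈ K`. [folklore] -/
theorem kap2_inv_inK {k : H} (hk : InK2 c₁ c₂ k) : κ₂ k⁻¹ = -κ₂ k := by
  rw [h.kap2_inv, h.inK_eps hk, one_mul]

/-- Elements with `ε = 1` centralise `K`. [folklore] -/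
theorem conj_inK_of_eps_one {g k : H} (hk : InK2 c₁ c₂ k) (he : ε g = 1) : g * k * g⁻¹ = k :=
  h.inK_eq_of_kap (h.inK_conj hk g) hk (by rw [kap1_conj_inK h g hk, he, one_mul])
    (by rw [kap2_conj_inK h g hk, he, one_mul])

/-- Elements with `ε = -1` invert `K`. [folklore] -/
theorem conj_inK_of_eps_neg {g k : H} (hk : InK2 c₁ c₂ k) (he : ε g = -1) : g * k * g⁻¹ = k⁻¹ :=
  h.inK_eq_of_kap (h.inK_conj hk g) (h.inK_inv hk) (by rw [kap1_conj_inK h g hk, he, kap1_inv_inK h hk]; ring)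
    (by rw [kap2_conj_inK h g hk, he, kap2_inv_inK h hk]; ring)

/-- Two elements with `ε = 1` commute. [folklore] -/
theorem comm_of_eps_one {x g : H} (hx : ε x = 1) (hg : ε g = 1) : x * g = g * x := by
  obtain ⟨u, hu, e⟩ := h.comm x g
  have hu1 : u = 1 := by
    apply h.inK_eq_one hu
    · have e1 := congrArg κ₁ e
      rw [h.kap1_mul, h.kap1_mul, h.kap1_mul, h.eps_mul, hx, hg] at e1
      linear_combination -e1
    · have e2 := congrArg κ₂ e
      rw [h.kap2_mul, h.kap2_mul, h.kap2_mul, h.eps_mul, hx, hg] at e2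
      linear_combination -e2
  rw [e, hu1, mul_one]

/-- An element with `ε = 1` and `κ = 0` is central. [folklore] -/
theorem central_of_kap_zero {g : H} (hg : ε g = 1) (h1 : κ₁ g = 0) (h2 : κ₂ g = 0) (x : H) : x * g = g * x := by
  obtain ⟨u, hu, e⟩ := h.comm x g
  have hu1 : u = 1 := by
    apply h.inK_eq_one hu
    · have e1 := congrArg κ₁ e
      rw [h.kap1_mul, h.kap1_mul, h.kap1_mul, h.eps_mul, hg, h1] at e1
      rcases h.sign x with ex | ex <;> rw [ex] at e1
      · linear_combination -e1
      · linear_combination e1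
    · have e2 := congrArg κ₂ e
      rw [h.kap2_mul, h.kap2_mul, h.kap2_mul, h.eps_mul, hg, h2] at e2
      rcases h.sign x with ex | ex <;> rw [ex] at e2
      · linear_combination -e2
      · linear_combination e2
  rw [e, hu1, mul_one]

/-- `κ₁(gⁿ) = n κ₁(g)` when `ε g = 1`. [folklore] -/
theorem kap1_pow_of_eps_one {g : H} (hg : ε g = 1) (n : ℕ) : κ₁ (g ^ n) = n * κ₁ g := by
  induction n with
  | zero => rw [pow_zero, h.kap1_one, Nat.cast_zero, zero_mul]
  | succ n ih => rw [pow_succ, h.kap1_mul, eps_pow h, hg, one_pow, one_mul, ih]; push_cast; ring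

/-- `κ₂(gⁿ) = n κ₂(g)` when `ε g = 1`. [folklore] -/
theorem kap2_pow_of_eps_one {g : H} (hg : ε g = 1) (n : ℕ) : κ₂ (g ^ n) = n * κ₂ g := by
  induction n with
  | zero => rw [pow_zero, h.kap2_one, Nat.cast_zero, zero_mul]
  | succ n ih => rw [pow_succ, h.kap2_mul, eps_pow h, hg, one_pow, one_mul, ih]; push_cast; ring

/-- An element with `ε = 1` whose order is prime to `3` has `κ = 0`, hence is central. [folklore] -/
theorem central_of_eps_one_of_coprime {g : H} (hg : ε g = 1) (hcop : (orderOf g).Coprime 3) (x : H) :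
    x * g = g * x := by
  have hn : ((orderOf g : ℕ) : ZMod 3) ≠ 0 := by
    rw [Ne, ZMod.natCast_eq_zero_iff]
    intro h3
    have := Nat.Coprime.eq_one_of_dvd hcop.symm h3  -- 3 ∣ orderOf g, coprime ⇒ 3 = 1
    exact absurd this (by norm_num)
  have key : ∀ a b : ZMod 3, a ≠ 0 → a * b = 0 → b = 0 := by decide
  have h1 : κ₁ g = 0 := by
    have := kap1_pow_of_eps_one h hg (orderOf g)
    rw [pow_orderOf_eq_one, h.kap1_one] at this
    exact key _ _ hn this.symm
  have h2 : κ₂ g = 0 := by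
    have := kap2_pow_of_eps_one h hg (orderOf g)
    rw [pow_orderOf_eq_one, h.kap2_one] at this
    exact key _ _ hn this.symm
  exact central_of_kap_zero h hg h1 h2 x

/-- Coordinates of `c₁^a c₂^b`. [folklore] -/
theorem kap_inK_pow (a b : ℕ) : κ₁ (c₁ ^ a * c₂ ^ b) = a ∧ κ₂ (c₁ ^ a * c₂ ^ b) = b := by
  have e1 : ε (c₁ ^ a) = 1 := by rw [eps_pow h, h.eps_c1, one_pow]
  constructor
  · rw [h.kap1_mul, e1, one_mul, kap1_pow_of_eps_one h h.eps_c1, kap1_pow_of_eps_one h h.eps_c2, h.kap1_c1, h.kap1_c2]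
    ring
  · rw [h.kap2_mul, e1, one_mul, kap2_pow_of_eps_one h h.eps_c1, kap2_pow_of_eps_one h h.eps_c2, h.kap2_c1, h.kap2_c2]
    ring

/-- `c₁ ≠ 1`. [folklore] -/
theorem c1_ne_one : c₁ ≠ 1 := by
  intro e
  have := h.kap1_c1
  rw [e, h.kap1_one] at this
  exact absurd this (by decide)

end CoordLift

end Summit.MatrixMultiplication.OmegaCensus
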